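import Literature.MathematicalPhysics.QuantumFieldTheory.QCDPhaseQuenchedReweighting
import Literature.Probability.Moments.FractionalMomentTail
import HarnessLib

/-!
# Phase-quenched lattice QCD: first moments from fractional moments plus a tail

Topic `Literature/MathematicalPhysics/QuantumFieldTheory`; namespace
`Literature.MathematicalPhysics.QuantumFieldTheory`.

The `|det D|`-reweighted Wilson average `⟨φ⟩₊ = ∫|det D| φ dμ_W / ∫|det D| dμ_W` (the quotient inlined
in routes `WilsonMobilityGap` / `PauliWegnerSea`, items `MobilityGap`, `PhaseQuenchedFlavourDecay`,
`FMClosureUnquenched`) is the expectation under the probability measure `qcdLatticeMeasure`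
(tree `qcdPhaseQuenchedExpect_eq_div`, `qcdPhaseQuenchedExpect_eq_integral_qcdLatticeMeasure`,
`isProbabilityMeasure_qcdLatticeMeasure`).  Hence the layer-cake lemma of
`Literature/Probability/Moments/FractionalMomentTail.lean` applies verbatim:

* `phaseQuenched_firstMoment_le_of_fractionalMoment_of_tail` — for a non-negative observable `φ`
  integrable under the phase-quenched measure, `0 < σ < 1 < p`, a phase-quenched tail
  `P₊(φ > t) ≤ B t^{-p}` and any threshold `T > 0`:
  `⟨φ⟩₊ ≤ T^{1-σ} ⟨φ^σ⟩₊ + B (p/(p-1)) T^{1-p}`;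
* `phaseQuenched_firstMoment_le_exp_of_fractionalMoment_exp_of_tail` — the exponential form
  (`⟨φ^σ⟩₊ ≤ C e^{-x}` ⇒ `⟨φ⟩₊ ≤ (C + B p/(p-1)) e^{-((p-1)/(p-σ)) x}`).

With `φ = Σ_{colour,spin} |G_f(0,v)|` (or a Wick minor of `G_f`), `x = δ a_k ‖v‖`, this is the
upgrade from the fractional-moment clause (ii) of `MobilityGap` (`s < 1`) to first moments,
CONDITIONAL on a volume-uniform polynomial tail of order `p > 1` under the phase-quenched measure —
the "local Wegner-type" input isolated by the refuter analysis of crux stmt-QuantumFields-9151.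
Also: `integrable_norm_inv_diracMatrix_apply_qcdLatticeMeasure` /
`integrable_propagatorEntrySum_qcdLatticeMeasure` — every propagator entry (and the colour–spin entry
sum of the routes) is integrable under `qcdLatticeMeasure` when `∫|det D| dμ_W > 0`, because
`|det D|·|D⁻¹(p,q)| ≤ |adj D(p,q)|` is bounded on the compact configuration space; this discharges
the integrability hypothesis of the two theorems for `φ = Σ|G_f|`.
Pure measure theory over the tree's objects; nothing about localisation is claimed.
-/

noncomputable section

open MeasureTheory Filter
open Literature.MathematicalPhysics.QuantumLattice Literature.Probability.LatticeModels
  Literature.Probability.Moments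

namespace Literature.MathematicalPhysics.QuantumFieldTheory

variable {Nf : ℕ} {S : ℕ} [NeZero S]

/-- **`⟨φ⟩₊ ≤ T^{1-σ}⟨φ^σ⟩₊ + B·(p/(p-1))·T^{1-p}`** for a non-negative phase-quenched-integrable
observable with phase-quenched tail `P₊(φ > t) ≤ B t^{-p}` (`t > 0`), `0 < σ < 1 < p`, `T > 0`,
on any torus with non-degenerate weight `∫|det D| dμ_W > 0` (both sides written as the literal
quotients of the routes). [folklore] -/
theorem phaseQuenched_firstMoment_le_of_fractionalMoment_of_tail (β : ℝ) (mq : Fin Nf → ℝ)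
    (φ : GaugeConfig 4 S SU3 → ℝ) (hφ0 : ∀ U, 0 ≤ φ U)
    (hφi : Integrable φ (qcdLatticeMeasure S β mq))
    (hZ : 0 < ∫ U, ‖(diracMatrix U mq).det‖ ∂(wilsonMeasure (d := 4) (L := S) (fundamentalRep (Fin 3)) β))
    {σ p B T : ℝ} (hσ0 : 0 < σ) (hσ1 : σ < 1) (hp : 1 < p) (hT : 0 < T)
    (htail : ∀ t : ℝ, 0 < t → (qcdLatticeMeasure S β mq).real {U | t < φ U} ≤ B * t ^ (-p)) :
    (∫ U, ‖(diracMatrix U mq).det‖ * φ U ∂(wilsonMeasure (d := 4) (L := S) (fundamentalRep (Fin 3)) β)) /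
        (∫ U, ‖(diracMatrix U mq).det‖ ∂(wilsonMeasure (d := 4) (L := S) (fundamentalRep (Fin 3)) β)) ≤
      T ^ (1 - σ) *
        ((∫ U, ‖(diracMatrix U mq).det‖ * φ U ^ σ
            ∂(wilsonMeasure (d := 4) (L := S) (fundamentalRep (Fin 3)) β)) /
          (∫ U, ‖(diracMatrix U mq).det‖ ∂(wilsonMeasure (d := 4) (L := S) (fundamentalRep (Fin 3)) β))) +
        B * (p / (p - 1)) * T ^ (1 - p) := by
  haveI := isProbabilityMeasure_qcdLatticeMeasure (S := S) β mq hZ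
  have h1 := qcdPhaseQuenchedExpect_eq_div (S := S) β mq φ
  have h2 := qcdPhaseQuenchedExpect_eq_div (S := S) β mq (fun U => φ U ^ σ)
  rw [qcdPhaseQuenchedExpect_eq_integral_qcdLatticeMeasure] at h1 h2
  rw [← h1, ← h2]
  exact integral_le_of_fractionalMoment_of_tail _ hφ0 hφi hσ0 hσ1 hp hT htail

/-- **Exponential form**: `⟨φ^σ⟩₊ ≤ C e^{-x}` and the tail `P₊(φ > t) ≤ B t^{-p}` give
`⟨φ⟩₊ ≤ (C + B p/(p-1)) e^{-((p-1)/(p-σ)) x}`. With `x = δ a_k ‖v‖` this turns the `s < 1`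
fractional-moment decay of the quark propagator (clause (ii) of `MobilityGap`) into first-moment
decay at rate `δ (p-1)/(p-s)`, GIVEN the tail. [folklore] -/
theorem phaseQuenched_firstMoment_le_exp_of_fractionalMoment_exp_of_tail (β : ℝ) (mq : Fin Nf → ℝ)
    (φ : GaugeConfig 4 S SU3 → ℝ) (hφ0 : ∀ U, 0 ≤ φ U)
    (hφi : Integrable φ (qcdLatticeMeasure S β mq))
    (hZ : 0 < ∫ U, ‖(diracMatrix U mq).det‖ ∂(wilsonMeasure (d := 4) (L := S) (fundamentalRep (Fin 3)) β))
    {σ p B C x : ℝ} (hσ0 : 0 < σ) (hσ1 : σ < 1) (hp : 1 < p)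
    (hfm : (∫ U, ‖(diracMatrix U mq).det‖ * φ U ^ σ
            ∂(wilsonMeasure (d := 4) (L := S) (fundamentalRep (Fin 3)) β)) /
          (∫ U, ‖(diracMatrix U mq).det‖ ∂(wilsonMeasure (d := 4) (L := S) (fundamentalRep (Fin 3)) β)) ≤
        C * Real.exp (-x))
    (htail : ∀ t : ℝ, 0 < t → (qcdLatticeMeasure S β mq).real {U | t < φ U} ≤ B * t ^ (-p)) :
    (∫ U, ‖(diracMatrix U mq).det‖ * φ U ∂(wilsonMeasure (d := 4) (L := S) (fundamentalRep (Fin 3)) β)) /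
        (∫ U, ‖(diracMatrix U mq).det‖ ∂(wilsonMeasure (d := 4) (L := S) (fundamentalRep (Fin 3)) β)) ≤
      (C + B * (p / (p - 1))) * Real.exp (-((p - 1) / (p - σ) * x)) := by
  haveI := isProbabilityMeasure_qcdLatticeMeasure (S := S) β mq hZ
  have h1 := qcdPhaseQuenchedExpect_eq_div (S := S) β mq φ
  have h2 := qcdPhaseQuenchedExpect_eq_div (S := S) β mq (fun U => φ U ^ σ)
  rw [qcdPhaseQuenchedExpect_eq_integral_qcdLatticeMeasure] at h1 h2
  rw [← h1]
  rw [← h2] at hfm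
  exact integral_le_exp_of_fractionalMoment_exp_of_tail _ hφ0 hφi hσ0 hσ1 hp hfm htail

/-! ### Phase-quenched integrability of propagator entries (discharging the integrability
hypothesis above for the routes' quantity) -/

/-- `|det D| · |D⁻¹(p,q)| ≤ |adj D (p,q)|` (equality off `{det = 0}`, `0` on it). [folklore] -/
theorem norm_det_mul_norm_inv_apply_le {n : Type*} [Fintype n] [DecidableEq n] (A : Matrix n n ℂ)
    (p q : n) : ‖A.det‖ * ‖A⁻¹ p q‖ ≤ ‖A.adjugate p q‖ := by
  rw [Matrix.inv_def, Matrix.smul_apply, smul_eq_mul, norm_mul, ← mul_assoc, Ring.inverse_eq_inv',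
    norm_inv]
  by_cases h : A.det = 0
  · simp [h]
  · rw [mul_inv_cancel₀ (norm_ne_zero_iff.2 h), one_mul]

/-- Every propagator entry norm is integrable under the phase-quenched probability measure (its
product with the weight `|det D|` is an adjugate entry, bounded on the compact configuration
space), provided the weight is non-degenerate. [folklore] -/
theorem integrable_norm_inv_diracMatrix_apply_qcdLatticeMeasure (β : ℝ) (mq : Fin Nf → ℝ)
    (hZ : 0 < ∫ U, ‖(diracMatrix U mq).det‖ ∂(wilsonMeasure (d := 4) (L := S) (fundamentalRep (Fin 3)) β))
    (p q : FermiIdx Nf S) :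
    Integrable (fun U : GaugeConfig 4 S SU3 => ‖(diracMatrix U mq)⁻¹ p q‖) (qcdLatticeMeasure S β mq) := by
  obtain ⟨hZ0, hZT⟩ := partitionFunction_fundamental_ne_zero_and_ne_top (S := S) β
  -- finiteness of the Wilson weight
  haveI : IsFiniteMeasure (wilsonWeight (d := 4) (L := S) (fundamentalRep (Fin 3)) β) :=
    ⟨by simpa [partitionFunction] using hZT.lt_top⟩
  -- measurability of the entry
  have hadj : Continuous fun U : GaugeConfig 4 S SU3 => (diracMatrix U mq).adjugate p q :=
    ((continuous_diracMatrix (S := S) mq).matrix_adjugate).matrix_elem p q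
  have hmeas : Measurable fun U : GaugeConfig 4 S SU3 => ‖(diracMatrix U mq)⁻¹ p q‖ := by
    have h1 : (fun U : GaugeConfig 4 S SU3 => (diracMatrix U mq)⁻¹ p q) =
        fun U => Ring.inverse ((diracMatrix U mq).det) * (diracMatrix U mq).adjugate p q := by
      funext U; rw [Matrix.inv_def, Matrix.smul_apply, smul_eq_mul]
    have h2 : Measurable fun U : GaugeConfig 4 S SU3 => (diracMatrix U mq)⁻¹ p q := by
      rw [h1]
      refine Measurable.mul ?_ hadj.measurable
      have : (fun U : GaugeConfig 4 S SU3 => Ring.inverse ((diracMatrix U mq).det)) =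
          fun U => ((diracMatrix U mq).det)⁻¹ := by
        funext U; rw [Ring.inverse_eq_inv']
      rw [this]
      exact (continuous_det_diracMatrix (S := S) mq).measurable.inv
    exact h2.norm
  -- bound on the adjugate entry
  obtain ⟨C, hC⟩ : ∃ C : ℝ, ∀ U : GaugeConfig 4 S SU3, ‖(diracMatrix U mq).adjugate p q‖ ≤ C := by
    obtain ⟨U₀, -, hU₀⟩ := (isCompact_univ (X := GaugeConfig 4 S SU3)).exists_isMaxOn
      Set.univ_nonempty (hadj.norm.continuousOn)
    exact ⟨‖(diracMatrix U₀ mq).adjugate p q‖, fun U => hU₀ (Set.mem_univ U)⟩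
  -- integrability against the weight `|det| dwilsonWeight`
  have hdens : Measurable fun U : GaugeConfig 4 S SU3 =>
      ENNReal.ofReal (∏ f, ‖fermionDet (wilsonDirac (fundamentalRep (Fin 3)) U (mq f) 1)‖) := by
    have := measurable_norm_det_diracMatrix (S := S) mq
    simp_rw [norm_det_diracMatrix] at this
    exact this.ennreal_ofReal
  have hW : Integrable (fun U : GaugeConfig 4 S SU3 => ‖(diracMatrix U mq)⁻¹ p q‖)
      (qcdLatticeWeight S β mq) := by
    rw [qcdLatticeWeight, integrable_withDensity_iff_integrable_smul' hdens
      (Eventually.of_forall fun _ => ENNReal.ofReal_lt_top)]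
    refine Integrable.of_bound (C := C) ?_ (Eventually.of_forall fun U => ?_)
    · exact ((hdens.ennreal_toReal).smul hmeas).aestronglyMeasurable
    · have h0 : 0 ≤ ∏ f, ‖fermionDet (wilsonDirac (fundamentalRep (Fin 3)) U (mq f) 1)‖ :=
        Finset.prod_nonneg fun f _ => norm_nonneg _
      rw [ENNReal.toReal_ofReal h0, ← norm_det_diracMatrix, smul_eq_mul, Real.norm_eq_abs,
        abs_of_nonneg (mul_nonneg (norm_nonneg _) (norm_nonneg _))]
      exact (norm_det_mul_norm_inv_apply_le _ p q).trans (hC U)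
  -- normalisation
  have huniv : qcdLatticeWeight S β mq Set.univ ≠ 0 := by
    rw [qcdLatticeWeight_univ]
    exact mul_ne_zero hZ0 (ENNReal.ofReal_pos.2 hZ).ne'
  rw [qcdLatticeMeasure]
  exact hW.smul_measure (ENNReal.inv_ne_top.2 huniv)

/-- The colour–spin entry sum of the propagator between two sites is phase-quenched integrable
(non-degenerate weight). [folklore] -/
theorem integrable_propagatorEntrySum_qcdLatticeMeasure (β : ℝ) (mq : Fin Nf → ℝ)
    (hZ : 0 < ∫ U, ‖(diracMatrix U mq).det‖ ∂(wilsonMeasure (d := 4) (L := S) (fundamentalRep (Fin 3)) β))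
    (f : Fin Nf) (x y : TorusSite 4 S) :
    Integrable (fun U : GaugeConfig 4 S SU3 => ∑ a : Fin 3, ∑ i : Fin 4, ∑ b : Fin 3, ∑ j : Fin 4,
      ‖(diracMatrix U mq)⁻¹ (quarkEquiv (f, (x, a, i))) (quarkEquiv (f, (y, b, j)))‖)
      (qcdLatticeMeasure S β mq) := by
  refine integrable_finsetSum _ fun a _ => integrable_finsetSum _ fun i _ =>
    integrable_finsetSum _ fun b _ => integrable_finsetSum _ fun j _ => ?_
  exact integrable_norm_inv_diracMatrix_apply_qcdLatticeMeasure β mq hZ _ _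

end Literature.MathematicalPhysics.QuantumFieldTheory

end
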